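import Mathlib
import Literature.Probability.Percolation.CornerPercolation
import Literature.Probability.Percolation.PercolationEvents
import Summits.CriticalPhenomena.CardyFormulaZ2.Theses.CardySelfDualSegment

/-!
# Sketch (crux-ideate, ideator 3) — UniformMarginality (stmt-CriticalPhenomena-5472)

First lemmas of the line `pivotal-balance-heat-flow`: the Russo / heat-flow identity for the
corner family `M_t = cornerPercolation t` and its consequence, the PIVOTAL BALANCE identity
`E_t[#Piv ; Aᶜ] − E_t[#Piv ; A] = 4 (1 − t) ∂_t P_t(A)`; plus the differential sufficient
condition `RussoBound` for the crux.  Statements only (Props); nothing is proved here.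
-/

noncomputable section

namespace Summit.CriticalPhenomena.CardyFormulaZ2.Cruxes.UniformMarginality.Ideator3

open MeasureTheory Literature.Probability.Percolation Literature.Probability.LatticeModels
  Literature.Probability.RandomPlanarGeometry
open scoped Classical

/-- The crude crossing event of the conformal rectangle `R` at mesh `δ` on `√2 ℤ²`
(the event inside `cornerCrossingProb`). -/
def crossEvent (R : ConformalRectangle) (δ : ℝ) : Set (BondConfig (Site 2)) :=
  embDomainCrossing squareLatticeEmbedding.z R.carrier δ (R.arc 0) (R.arc 2)

/-- The north edge `{v, v + (0,1)}` and the east edge `{v, v + (1,0)}` of a vertex. -/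
def northEdge (v : Site 2) : Sym2 (Site 2) := s(v, v + ![0, 1])
def eastEdge (v : Site 2) : Sym2 (Site 2) := s(v, v + ![1, 0])

/-- `P_t(R, δ)` extended to a function of a real parameter (constant outside `[0,1]`). -/
def Pext (R : ConformalRectangle) (δ : ℝ) (s : ℝ) : ℝ :=
  cornerCrossingProb (Set.projIcc (0 : ℝ) 1 zero_le_one s) R δ

/-- The law `M_t` at a real parameter (projected to `[0,1]`). -/
def M (s : ℝ) : Measure (BondConfig (Site 2)) :=
  cornerPercolation (Set.projIcc (0 : ℝ) 1 zero_le_one s)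

/-- Russo integrand of the corner deformation at the vertex `v`:
`X_v(ω) = (1 − 2·𝟙{E_v ∈ ω}) · 𝟙{N_v pivotal for A in ω}`. -/
def russoIntegrand (A : Set (BondConfig (Site 2))) (v : Site 2) (ω : BondConfig (Site 2)) : ℝ :=
  (if eastEdge v ∈ ω then (-1 : ℝ) else 1) * (if IsPivotal A (northEdge v) ω then 1 else 0)

/-- Number of pivotal edges for `A` in `ω` among the edges of the finite set `K`. -/
def pivCountIn (K : Finset (Sym2 (Site 2))) (A : Set (BondConfig (Site 2)))
    (ω : BondConfig (Site 2)) : ℕ :=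
  (K.filter fun e => IsPivotal A e ω).card

/-- **Russo / heat-flow identity** (first lemma, provable now: finite Margulis–Russo in the
splitting bits `d_v ~ Bernoulli(t/2)`; flipping `d_v` flips the north edge `N_v`, in the direction
`closed → open` iff the coin `c_v = 𝟙{E_v open}` is `0`):
`∂_t P_t(R,δ) = ½ Σ_v E_t[(1 − 2 c_v) 𝟙{N_v pivotal}]`, the sum ranging over the finitely many
vertices whose north edge meets the domain. -/
def RussoIdentity : Prop :=
  ∀ (R : ConformalRectangle) (δ : ℝ), 0 < δ → ∃ K : Finset (Site 2),
    (∀ ω, ∀ v ∉ K, ¬ IsPivotal (crossEvent R δ) (northEdge v) ω) ∧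
    ∀ t ∈ Set.Ioo (0 : ℝ) 1,
      HasDerivAt (Pext R δ)
        ((1 / 2 : ℝ) * ∑ v ∈ K, ∫ ω, russoIntegrand (crossEvent R δ) v ω ∂(M t)) t

/-- **Pivotal balance** (exact, all `t ∈ (0,1)`, all meshes; from `RussoIdentity`, the
conditional law `P_t(N_v open | rest) = (1 − t/2)𝟙{E_v open} + (t/2)𝟙{E_v closed}` (and the same
with `E`, `N` exchanged), and the transpose symmetry `cornerPercolation_map_relabel_transpose`):
`E_t[#Piv(A) ; Aᶜ] − E_t[#Piv(A) ; A] = 4 (1 − t) ∂_t P_t`, where `#Piv` counts ALL pivotal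
edges (horizontal and vertical).  At `t = 1` both sides vanish (pivotality is independent of the
edge's own state); UniformMarginality in differential form says the left side is `O(1 − t)`
uniformly in the mesh. -/
def PivotalBalance : Prop :=
  ∀ (R : ConformalRectangle) (δ : ℝ), 0 < δ → ∃ K : Finset (Sym2 (Site 2)),
    (∀ ω, pivotals (crossEvent R δ) ω ⊆ (↑K : Set (Sym2 (Site 2)))) ∧
    ∀ t ∈ Set.Ioo (0 : ℝ) 1,
      ∫ ω, (pivCountIn K (crossEvent R δ) ω : ℝ) *
          (if ω ∈ crossEvent R δ then (-1 : ℝ) else 1) ∂(M t)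
        = 4 * (1 - t) * deriv (Pext R δ) t

/-- **RussoBound** (the differential sufficient condition; this is what a bound on the
chiral / five-arm census delivers): the Russo sum is locally bounded in `t`, uniformly in the
mesh. With `RussoIdentity`, the mean value theorem and the finiteness of the family
`{P_·(R,δ) : δ ≥ δ₀}` it implies the crux `UniformMarginality` (Lipschitz form). -/
def RussoBound : Prop :=
  ∀ (R : ConformalRectangle) (t₀ : ℝ), t₀ ∈ Set.Icc (0 : ℝ) 1 → ∃ η > 0, ∃ C : ℝ,
    ∀ δ : ℝ, 0 < δ → ∀ t ∈ Set.Ioo (0 : ℝ) 1, |t - t₀| < η → |deriv (Pext R δ) t| ≤ C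

/-- **Integrated form** (robust to a logarithmic Russo sum — the `c = 0` Jordan-cell scenario):
a modulus of continuity for `t ↦ P_t(R,δ)` uniform in the mesh.  This IS the crux up to the
identification `Pext R δ t = P t R δ` on `[0,1]` (`cornerCrossingProb` is the route's `P`). -/
def IntegratedBound : Prop :=
  ∀ (R : ConformalRectangle) (t₀ : ℝ), t₀ ∈ Set.Icc (0 : ℝ) 1 → ∀ ε > 0, ∃ η > 0,
    ∀ δ : ℝ, 0 < δ → ∀ t ∈ Set.Icc (0 : ℝ) 1, |t - t₀| < η → |Pext R δ t - Pext R δ t₀| < ε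

/-- Sanity link (statement only): the integrated bound is literally the crux. -/
def IntegratedBoundGivesCrux : Prop :=
  IntegratedBound → Summit.CriticalPhenomena.CardyFormulaZ2.Theses.CardySelfDualSegment.UniformMarginality

end Summit.CriticalPhenomena.CardyFormulaZ2.Cruxes.UniformMarginality.Ideator3

end

namespace Summit.CriticalPhenomena.CardyFormulaZ2.Cruxes.UniformMarginality.Ideator3

open MeasureTheory Literature.Probability.Percolation Literature.Probability.LatticeModels
  Literature.Probability.RandomPlanarGeometry

/-- The extended function agrees with the route's `P t R δ` on `[0,1]` (definitional). -/
theorem Pext_coe (R : ConformalRectangle) (δ : ℝ) (t : unitInterval) :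
    Pext R δ (t : ℝ) = cornerCrossingProb t R δ := by
  unfold Pext
  rw [Set.projIcc_val]

/-- GLUE (proved): the integrated bound is the crux `UniformMarginality` by name. -/
theorem integratedBound_gives_crux : IntegratedBoundGivesCrux := by
  intro h
  unfold Summit.CriticalPhenomena.CardyFormulaZ2.Theses.CardySelfDualSegment.UniformMarginality
  intro prm cfg P t₀ R ε hε
  obtain ⟨η, hη, hmain⟩ := h R (t₀ : ℝ) t₀.2 ε hε
  refine ⟨η, hη, fun t ht δ hδ => ?_⟩
  have hdist : dist t t₀ = |(t : ℝ) - (t₀ : ℝ)| := by rw [Subtype.dist_eq, Real.dist_eq]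
  have key := hmain δ hδ (t : ℝ) t.2 (by rw [← hdist]; exact ht)
  have hP : ∀ s : unitInterval, P s R δ = Pext R δ (s : ℝ) := by
    intro s
    rw [Pext_coe]
    rfl
  rw [hP t, hP t₀]
  exact key

end Summit.CriticalPhenomena.CardyFormulaZ2.Cruxes.UniformMarginality.Ideator3
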